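import Mathlib

set_option linter.dupNamespace false

/-!
# SoloBlind E59 — the algebra of Conjecture V (Eisenstein depth of the new quotient at level `pq`)

Solo-blind programme, tower note §13.16 / claim C455.  For primes `p ≠ q` and a prime `ℓ ≥ 5` not dividing
`pq`, Conjecture V asserts that the `ℓ`-adic length `μ` of `𝕋^{new}(Γ₀(pq)) / I^{++}` equals

  `V = a_p + a_q − max (o_p, o_q)`,

where `a_p = v_ℓ(p−1)`, `a_q = v_ℓ(q−1)`, `o_p = v_ℓ(ord_p q)` (multiplicative order of `q` mod `p`) and
`o_q = v_ℓ(ord_q p)`.  Since `ord_p q ∣ p − 1` we always have `o_p ≤ a_p` and `o_q ≤ a_q`.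
This file contains NO modular forms: it records, as kernel-checked arithmetic of the function `V`, the
consequences quoted in C455 — the window `min(a_p,a_q) ≤ V ≤ a_p + a_q` (the upper end is the rigorous
constant-term ceiling, the lower end the `c_old` bound of E57), the characterisation of the ceiling
(beyond-Mazur cells), and the depth-one criterion, which has exactly the shape of the Ribet–Yoo existence
theorem for `(+,+)` Eisenstein newforms (Yoo, Trans. AMS 2019, arXiv:1409.8342, Thm 1.3).
-/

namespace Summit.Langlands.Langlands.Theorems.SoloBlindDepthLawV

/-- The conjectured depth `V(a_p, a_q; o_p, o_q) = a_p + a_q − max(o_p, o_q)` (natural subtraction). -/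
def V (ap aq op oq : ℕ) : ℕ := ap + aq - max op oq

/-- Ceiling: `V ≤ a_p + a_q` (the constant-term valuation `v_ℓ((p−1)(q−1)/24)` for `ℓ ≥ 5`). -/
theorem V_le_sum (ap aq op oq : ℕ) : V ap aq op oq ≤ ap + aq := by
  unfold V; omega

/-- Floor: under the structural constraints `o_p ≤ a_p`, `o_q ≤ a_q` one has `min(a_p, a_q) ≤ V`. -/
theorem min_le_V (ap aq op oq : ℕ) (hp : op ≤ ap) (hq : oq ≤ aq) :
    min ap aq ≤ V ap aq op oq := by
  unfold V; omega

/-- The ceiling is attained exactly when both covering orders are prime to `ℓ` (`o_p = o_q = 0`):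
these are the "beyond-Mazur" cells, e.g. `(p,q,ℓ) = (11,241,5), (31,191,5)`. -/
theorem V_eq_sum_iff (ap aq op oq : ℕ) (hp : op ≤ ap) (hq : oq ≤ aq) :
    V ap aq op oq = ap + aq ↔ op = 0 ∧ oq = 0 := by
  unfold V; omega

/-- `V` exceeds both prime-level depths `max(a_p, a_q)` iff `max(o_p, o_q) < min(a_p, a_q)`. -/
theorem max_lt_V_iff (ap aq op oq : ℕ) (hp : op ≤ ap) (hq : oq ≤ aq) :
    max ap aq < V ap aq op oq ↔ max op oq < min ap aq := by
  unfold V; omega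

/-- Depth-one criterion, one-sided case (the Ribet–Yoo shape): if `a_q = 0 < a_p` then
`1 ≤ V ↔ o_p < a_p`, i.e. iff `q` is NOT of maximal `ℓ`-power order mod `p` — equivalently `q` is an
`ℓ`-th power modulo `p`. -/
theorem one_le_V_iff_onesided (ap op oq : ℕ) (hp : op ≤ ap) (hq : oq ≤ 0) (hap : 1 ≤ ap) :
    1 ≤ V ap 0 op oq ↔ op < ap := by
  unfold V; omega

/-- Depth-one criterion, two-sided case: if `a_p ≥ 1` and `a_q ≥ 1` (both primes `≡ 1 (mod ℓ)`) then
`V ≥ 1` unconditionally. -/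
theorem one_le_V_twosided (ap aq op oq : ℕ) (hp : op ≤ ap) (hq : oq ≤ aq) (hap : 1 ≤ ap)
    (haq : 1 ≤ aq) : 1 ≤ V ap aq op oq := by
  unfold V; omega

/-- General depth-one criterion: with `a_p + a_q ≥ 1`, `V = 0` iff one side is "empty and generating":
(`a_q = 0` and `o_p = a_p`) or (`a_p = 0` and `o_q = a_q`). -/
theorem V_eq_zero_iff (ap aq op oq : ℕ) (hp : op ≤ ap) (hq : oq ≤ aq) (h : 1 ≤ ap + aq) :
    V ap aq op oq = 0 ↔ (aq = 0 ∧ op = ap) ∨ (ap = 0 ∧ oq = aq) := by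
  unfold V; omega

/-- Symmetry of the law in the two primes. -/
theorem V_symm (ap aq op oq : ℕ) : V ap aq op oq = V aq ap oq op := by
  unfold V; rw [Nat.add_comm, max_comm]

/-- Worked cell `(11, 61)` at `ℓ = 5`: `a = (1,1)`, `ord_11(61) = 10` (`o = 1`), `ord_61(11)` prime to 5
(`o = 0`): `V = 1` (measured `μ = 1`, exact module `M'_{++} = 5`). -/
example : V 1 1 1 0 = 1 := by decide

/-- Worked cell `(11, 241)` at `ℓ = 5`: `a = (1,1)`, `241 ≡ −1 (mod 11)` and `11` has order prime to `5`
in `(ℤ/241)^×/…`: `o = (0,0)`, `V = 2 = a_p + a_q` — a beyond-Mazur cell (measured `μ = 2`). -/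
example : V 1 1 0 0 = 2 := by decide

/-- Worked cell `(41, 101)` at `ℓ = 5`: `a = (1,2)`; `101 ≡ 19` has order `40` mod `41` and `41` has
order divisible by `5` but not `25` mod `101`, so `o = (1,1)`: `V = 2` (measured `μ = 2`; a law capped at
the prime-level positions would give `1`). -/
example : V 1 2 1 1 = 2 := by decide

end Summit.Langlands.Langlands.Theorems.SoloBlindDepthLawV
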